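import Summits.HodgeConjecture.HodgeConjecture.Theses.TropicalWeilObstruction
import HarnessLib

/-!
# Assembly of route `TropicalWeilObstruction` (stmt-HodgeConjecture-18482)

The assembly item of the refutation route `TropicalWeilObstruction` is pure logic over its four
items: assume the Hodge conjecture; take a Weil-generic period matrix `Q` (`GenericWeilPeriod`);
`MumfordWeilShadow` gives a complex abelian eightfold `A` with `φ² = -1` and three rational
`(4,4)`-classes `u₀, u₁, u₂` spanning a cup-non-degenerate `ℚ`-space, together with the shadow
property; `A.X` is smooth projective of dimension `A.dim = 8`
(`AbelianVariety.isSmoothProjective_holds`), so the Hodge conjecture makes every `u_k` algebraic;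
the shadow property (with `m = 3`) casts them to three effective tropical `4`-cycles with
`ℚ`-linearly independent classes; `TropicalWeilVanishing` kills their Weil functionals and
`TropicalHodgeBound` says such cycles have dependent classes — contradiction.
-/

set_option linter.dupNamespace false

namespace Summit.HodgeConjecture.HodgeConjecture.Theorems

open Summit.HodgeConjecture.HodgeConjecture.Theses.TropicalWeilObstruction in
/-- **Assembly of route `TropicalWeilObstruction`** (item stmt-HodgeConjecture-18482):
`TropicalWeilVanishing → MumfordWeilShadow → TropicalHodgeBound → GenericWeilPeriod → ¬ HC`.
Pure logic: the Hodge conjecture at the abelian eightfold `A` of `MumfordWeilShadow`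
(smooth projective of dimension `A.dim = 8`, `AbelianVariety.isSmoothProjective_holds`) makes the
three shadow-generating classes algebraic; the shadow gives three effective tropical `4`-cycles with
independent classes, whose Weil functionals vanish (`TropicalWeilVanishing`), contradicting
`TropicalHodgeBound`. -/
theorem tropicalWeilObstruction_assembly_proof :
    Summit.HodgeConjecture.HodgeConjecture.Theses.TropicalWeilObstruction.Assembly := by
  intro h₁ h₂ h₃ h₄ hHC
  obtain ⟨Q, hQ, hQJ, hgen⟩ := h₄
  obtain ⟨A, φ, u, hdim, -, hu, -, -, hnd, hshadow⟩ := h₂ Q hQ hQJ hgen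
  have hsp : Literature.AlgebraicGeometry.Motives.IsSmoothProjective A.dim A.X :=
    Literature.AlgebraicGeometry.Motives.AbelianVariety.isSmoothProjective_holds
  rw [hdim] at hsp
  have hHCA : Literature.AlgebraicGeometry.HodgeTheory.HodgeConjectureFor 8 A.X := hHC hsp
  have halg : ∀ k, u k ∈ Literature.AlgebraicGeometry.HodgeTheory.algebraicClasses A.X 4 :=
    fun k ↦ hHCA.2 4 (u k) (hu k).1 (hu k).2
  obtain ⟨c, hc⟩ := hshadow 3 u (fun k ↦ (hu k).1) halg hnd
  exact h₃ Q hQ hQJ hgen c (fun j ↦ h₁ Q hQ hQJ hgen (c j)) hc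

end Summit.HodgeConjecture.HodgeConjecture.Theorems
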